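import Mathlib.RingTheory.Polynomial.Chebyshev
import Mathlib.Data.Real.Basic

/-!
# Explicit Chebyshev polynomials of the first kind `T_k`, `k ≤ 5`, evaluated over `ℝ`

Framing: lottery ticket; floor = certified bounds/negative ranges. Venture `PackingBounds` (cell
`pub-packcert`, seat `pub-packcert-energy`): `(T ℝ k).eval t` written out for the polygon certificates
(`UniversalOptimalityPolygon*.lean`). [folklore]
-/

noncomputable section

namespace Summit.Ventures.PackingBounds.Energy

open Polynomial Polynomial.Chebyshev

namespace ChebyshevT

/-- `T_0(t) = 1`. [folklore] -/
theorem t0 (t : ℝ) : (T ℝ 0).eval t = 1 := by simp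

/-- `T_1(t) = t`. [folklore] -/
theorem t1 (t : ℝ) : (T ℝ 1).eval t = t := by simp

/-- `T_2(t) = 2t² - 1`. [folklore] -/
theorem t2 (t : ℝ) : (T ℝ 2).eval t = 2 * t ^ 2 - 1 := by
  simp [T_two]

/-- `T_3(t) = 4t³ - 3t`. [folklore] -/
theorem t3 (t : ℝ) : (T ℝ 3).eval t = 4 * t ^ 3 - 3 * t := by
  have h : T ℝ 3 = 2 * X * T ℝ 2 - T ℝ 1 := by simpa using T_add_two (R := ℝ) 1
  rw [h]
  simp [T_two]
  ring

/-- `T_4(t) = 8t⁴ - 8t² + 1`. [folklore] -/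
theorem t4 (t : ℝ) : (T ℝ 4).eval t = 8 * t ^ 4 - 8 * t ^ 2 + 1 := by
  have h : T ℝ 4 = 2 * X * T ℝ 3 - T ℝ 2 := by simpa using T_add_two (R := ℝ) 2
  rw [h]
  simp [t3, t2]
  ring

/-- `T_5(t) = 16t⁵ - 20t³ + 5t`. [folklore] -/
theorem t5 (t : ℝ) : (T ℝ 5).eval t = 16 * t ^ 5 - 20 * t ^ 3 + 5 * t := by
  have h : T ℝ 5 = 2 * X * T ℝ 4 - T ℝ 3 := by simpa using T_add_two (R := ℝ) 3
  rw [h]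
  simp [t4, t3]
  ring

end ChebyshevT

end Summit.Ventures.PackingBounds.Energy

end
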